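import Literature.Analysis.Asymptotics.LinearRecurrenceDeflationGeneral
import HarnessLib

/-!
# A linear recurrence with a simple dominant root `1` and a SOURCE which is a polynomial of degree ≤ 1 plus a geometric error:
# the solution is a QUADRATIC polynomial plus a geometric error, with the two leading coefficients explicit
# (module «LINEAR RECURRENCE WITH POLYNOMIAL SOURCE»)

Topic `Literature/Analysis/Asymptotics` (continues «LINEAR RECURRENCE DEFLATION — GENERAL ORDER» `LinearRecurrenceDeflationGeneral.lean` —
`Literature.Analysis.recDeflate`, `recDeflate_eq_sum_coeff`, ★ `exists_norm_le_of_recDeflate` (inhomogeneous deflation of any order),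
`exists_norm_sub_le_of_linearRecurrence_one` (homogeneous, simple dominant root `1`)).  Lane «pcv-sawmu» (CriticalPhenomena venture), a-p2 g29 —
the model-free input of the width-three CONTACT-VARIANCE programme: the contact-weighted hat bridge sums `Ĉ`, `Ĉ²` of the strip `S₃` satisfy the SAME
order-`24` scalar recurrence as the bridge sums `D̂` (characteristic polynomial `(X − 1)·Q`, all roots of `Q` in `‖z‖ ≤ 0.97`), but with SOURCES —
`y∂_y` of the recurrence — which converge geometrically (for `Ĉ`) or grow linearly up to a geometric error (for `Ĉ²`).  This module turns such a
recurrence into an asymptotic expansion with explicit leading coefficients: the discrete analogue of «a pole of order `m` at `1` contributes a polynomial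
of degree `m − 1`» (R. P. Stanley, EC1 (2012) §4.1 Theorem 4.1.1 (iii) / Corollary 4.3.1), with W. Feller I (1968) XIII.6 (first two moments of the
number of renewals: `E N_k = k/μ + O(1)`, `Var N_k` linear) as the application in view.  Everything is elementary and quantitative; nothing is quoted
AS PRINTED.

## What is proved (namespace `Literature.Analysis`)

* §1 Tails: `summable_succ_pow_mul_geometric_of_pos` (`Σ (n+1)^m Rⁿ < ∞`), ★ `norm_tsum_nat_add_le_of_norm_le` (`‖v_i‖ ≤ C(i+1)^mRⁱ ⇒ ‖Σ_{i≥n} v_i‖ ≤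
  C·S·(n+1)^mRⁿ`), `tendsto_succ_pow_mul_of_abs_le` (a geometric bound beats every polynomial weight: `(n+1)^p·e_n → 0`).
* §2 Plumbing on polynomials: `eval_one_eq_sum_range_coeff`, `eval_one_ne_zero_of_root_norm_le`, `recDeflate_affine` (deflation of `n ↦ αn + β`:
  `α(n·Σ_j c_j + Σ_j j·c_j) + β·Σ_j c_j`), `two_mul_sum_range_cast_complex` (`2Σ_{i<n} i = n² − n`).
* §3 ★★★ **`exists_norm_sub_quadratic_le_of_linearRecurrence_one`**: `q ∈ ℂ[X]` monic, all roots in `‖z‖ ≤ R` (`0 < R < 1`), `Σ_j q_j = Q₁`,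
  `Σ_j j·q_j = Q_d`; if `‖Σ_{j ≤ deg q} q_j (w_{n+1+j} − w_{n+j}) − (ℓ₁ n + ℓ₀)‖ ≤ C(n+1)^kRⁿ` for all `n`, then with `α = ℓ₁/Q₁`, `β = (ℓ₀ − αQ_d)/Q₁`
  there are `m₀` and `C'` with `‖w_n − (α/2·n² + (β − α/2)·n + m₀)‖ ≤ C'(n+1)^{k + deg q}Rⁿ` for all `n` (and `Q₁ ≠ 0`).  The case `ℓ₁ = 0` is the
  LINEAR law `w_n = (ℓ₀/Q₁)·n + m₀ + O((n+1)^{k+deg q}Rⁿ)`; the case `ℓ₁ = ℓ₀ = 0` is «DEFLATION — GENERAL ORDER» §6.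
* §4 ★★ `exists_abs_sub_quadratic_le_of_linearRecurrence_one_real` — the same for a REAL sequence and real data (the complex polynomial `q` enters only
  through its coefficients), the form used by the strip files.

Label: LANE THEOREM (own arrangement of lane «pcv-sawmu», a-p2 g29, 2026-08-28; the qualitative content is Stanley EC1 Thm 4.1.1 (iii)).  NOT claimed: sources of
higher polynomial degree (the same proof gives degree `d + 1` from degree `d`), optimal constants, the converse.
-/

noncomputable section

open Finset Filter Topology Polynomial

namespace Literature.Analysis

/-! ## §1 Polynomially weighted geometric tails -/

/-- `Σ_n (n+1)^m Rⁿ` converges for `0 < R < 1` (plumbing; shift of Mathlib's `summable_pow_mul_geometric_of_norm_lt_one`).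
[cite: Stanley2012EC1, §4.1 Theorem 4.1.1 (iii); lane plumbing] -/
theorem summable_succ_pow_mul_geometric_of_pos {R : ℝ} (hR : 0 < R) (hR1 : R < 1) (m : ℕ) :
    Summable fun n : ℕ => ((n : ℝ) + 1) ^ m * R ^ n := by
  have hnorm : ‖R‖ < 1 := by rw [Real.norm_eq_abs, abs_of_pos hR]; exact hR1
  have hRne : R ≠ 0 := hR.ne'
  have h0 : Summable fun n : ℕ => (n : ℝ) ^ m * R ^ n := summable_pow_mul_geometric_of_norm_lt_one m hnorm
  have h1 : Summable fun n : ℕ => ((n + 1 : ℕ) : ℝ) ^ m * R ^ (n + 1) := (summable_nat_add_iff 1).2 h0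
  have e : ∀ n : ℕ, R⁻¹ * (((n + 1 : ℕ) : ℝ) ^ m * R ^ (n + 1)) = ((n : ℝ) + 1) ^ m * R ^ n := fun n => by
    rw [Nat.cast_add, Nat.cast_one, pow_succ]
    calc R⁻¹ * (((n : ℝ) + 1) ^ m * (R ^ n * R)) = ((n : ℝ) + 1) ^ m * R ^ n * (R * R⁻¹) := by ring
      _ = ((n : ℝ) + 1) ^ m * R ^ n := by rw [mul_inv_cancel₀ hRne, mul_one]
  exact (h1.mul_left R⁻¹).congr e

/-- ★ **Tails.**  If `‖v_i‖ ≤ C·(i+1)^m·Rⁱ` for all `i` (`0 < R < 1`, `C ≥ 0`), then `v` is summable and for every `n`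
`‖Σ'_i v_{i+n}‖ ≤ C·S·(n+1)^m·Rⁿ` with `S = Σ'_j (j+1)^m R^j` (uses `(i+n+1) ≤ (n+1)(i+1)`).
[cite: Stanley2012EC1, §4.1 Theorem 4.1.1 (iii); lane statement with explicit constants] -/
theorem norm_tsum_nat_add_le_of_norm_le {v : ℕ → ℂ} {C R : ℝ} {m : ℕ} (hR : 0 < R) (hR1 : R < 1) (hC : 0 ≤ C)
    (hv : ∀ i : ℕ, ‖v i‖ ≤ C * ((i : ℝ) + 1) ^ m * R ^ i) (n : ℕ) :
    Summable v ∧ ‖∑' i, v (i + n)‖ ≤ C * (∑' j : ℕ, ((j : ℝ) + 1) ^ m * R ^ j) * ((n : ℝ) + 1) ^ m * R ^ n := by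
  have hS := summable_succ_pow_mul_geometric_of_pos hR hR1 m
  have hsum : Summable v := Summable.of_norm_bounded (hS.mul_left C) fun i => by simpa [mul_assoc] using hv i
  refine ⟨hsum, ?_⟩
  have hshift : ∀ i : ℕ, ‖v (i + n)‖ ≤ C * ((n : ℝ) + 1) ^ m * R ^ n * (((i : ℝ) + 1) ^ m * R ^ i) := fun i => by
    have h := hv (i + n)
    have hle : ((i + n : ℕ) : ℝ) + 1 ≤ ((n : ℝ) + 1) * ((i : ℝ) + 1) := by
      have hn : (0 : ℝ) ≤ (n : ℝ) := Nat.cast_nonneg n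
      have hi : (0 : ℝ) ≤ (i : ℝ) := Nat.cast_nonneg i
      rw [Nat.cast_add]
      nlinarith [mul_nonneg hn hi]
    have hle' : (((i + n : ℕ) : ℝ) + 1) ^ m ≤ (((n : ℝ) + 1) * ((i : ℝ) + 1)) ^ m :=
      pow_le_pow_left₀ (by positivity : (0 : ℝ) ≤ ((i + n : ℕ) : ℝ) + 1) hle m
    calc ‖v (i + n)‖ ≤ C * (((i + n : ℕ) : ℝ) + 1) ^ m * R ^ (i + n) := h
      _ ≤ C * (((n : ℝ) + 1) * ((i : ℝ) + 1)) ^ m * R ^ (i + n) :=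
          mul_le_mul_of_nonneg_right (mul_le_mul_of_nonneg_left hle' hC) (pow_nonneg hR.le _)
      _ = C * ((n : ℝ) + 1) ^ m * R ^ n * (((i : ℝ) + 1) ^ m * R ^ i) := by rw [mul_pow, pow_add]; ring
  have hsabs : Summable fun i => ‖v (i + n)‖ := Summable.of_nonneg_of_le (fun i => norm_nonneg _) hshift (hS.mul_left _)
  calc ‖∑' i, v (i + n)‖ ≤ ∑' i, ‖v (i + n)‖ := norm_tsum_le_tsum_norm hsabs
    _ ≤ ∑' i : ℕ, C * ((n : ℝ) + 1) ^ m * R ^ n * (((i : ℝ) + 1) ^ m * R ^ i) := hsabs.tsum_le_tsum hshift (hS.mul_left _)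
    _ = C * (∑' j : ℕ, ((j : ℝ) + 1) ^ m * R ^ j) * ((n : ℝ) + 1) ^ m * R ^ n := by rw [tsum_mul_left]; ring

/-- A geometric bound beats every polynomial weight: `|e_n| ≤ C(n+1)^kRⁿ` (`0 < R < 1`) ⇒ `(n+1)^p·e_n → 0` (plumbing).
[cite: Stanley2012EC1, §4.1 Theorem 4.1.1 (iii); lane plumbing] -/
theorem tendsto_succ_pow_mul_of_abs_le {e : ℕ → ℝ} {C R : ℝ} {k : ℕ} (hR : 0 < R) (hR1 : R < 1)
    (he : ∀ n : ℕ, |e n| ≤ C * ((n : ℝ) + 1) ^ k * R ^ n) (p : ℕ) :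
    Tendsto (fun n : ℕ => ((n : ℝ) + 1) ^ p * e n) atTop (𝓝 0) := by
  have hC : 0 ≤ C := by
    have h := he 0
    have h0 : (0 : ℝ) ≤ |e 0| := abs_nonneg _
    simp at h
    linarith
  -- `(n+1)^(p+k) Rⁿ → 0`
  have h0 : Tendsto (fun n : ℕ => ((n : ℝ)) ^ (p + k) * R ^ n) atTop (𝓝 0) :=
    tendsto_pow_const_mul_const_pow_of_lt_one (p + k) hR.le hR1
  have hRne : R ≠ 0 := hR.ne'
  have h0' : Tendsto (fun n : ℕ => (((n + 1 : ℕ) : ℝ)) ^ (p + k) * R ^ (n + 1)) atTop (𝓝 0) := (tendsto_add_atTop_iff_nat 1).2 h0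
  have hsh : ∀ n : ℕ, R⁻¹ * ((((n + 1 : ℕ) : ℝ)) ^ (p + k) * R ^ (n + 1)) = ((n : ℝ) + 1) ^ (p + k) * R ^ n := fun n => by
    rw [Nat.cast_add, Nat.cast_one, pow_succ]
    calc R⁻¹ * (((n : ℝ) + 1) ^ (p + k) * (R ^ n * R)) = ((n : ℝ) + 1) ^ (p + k) * R ^ n * (R * R⁻¹) := by ring
      _ = ((n : ℝ) + 1) ^ (p + k) * R ^ n := by rw [mul_inv_cancel₀ hRne, mul_one]
  have h1 : Tendsto (fun n : ℕ => ((n : ℝ) + 1) ^ (p + k) * R ^ n) atTop (𝓝 0) := by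
    have h := h0'.const_mul R⁻¹
    rw [mul_zero] at h
    exact h.congr hsh
  refine squeeze_zero_norm (fun n => ?_) (by simpa using h1.const_mul C)
  rw [Real.norm_eq_abs, abs_mul, abs_of_nonneg (by positivity : (0 : ℝ) ≤ ((n : ℝ) + 1) ^ p)]
  calc ((n : ℝ) + 1) ^ p * |e n| ≤ ((n : ℝ) + 1) ^ p * (C * ((n : ℝ) + 1) ^ k * R ^ n) :=
        mul_le_mul_of_nonneg_left (he n) (by positivity)
    _ = C * (((n : ℝ) + 1) ^ (p + k) * R ^ n) := by rw [pow_add]; ring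

/-! ## §2 Plumbing: coefficient sums, deflation of affine sequences, the Gauss sum -/

/-- `q(1) = Σ_{j ≤ deg q} q_j` (plumbing). [cite: Stanley2012EC1, §4.1; lane plumbing] -/
theorem eval_one_eq_sum_range_coeff (q : ℂ[X]) : q.eval 1 = ∑ j ∈ range (q.natDegree + 1), q.coeff j := by
  rw [eval_eq_sum_range]; simp

/-- If every root of `q` lies in `‖z‖ ≤ R < 1` then `q(1) ≠ 0` (plumbing). [cite: Stanley2012EC1, §4.1; lane plumbing] -/
theorem eval_one_ne_zero_of_root_norm_le {q : ℂ[X]} {R : ℝ} (hR1 : R < 1) (hroot : ∀ z : ℂ, q.IsRoot z → ‖z‖ ≤ R) :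
    q.eval 1 ≠ 0 := by
  intro h
  have h1 := hroot 1 h
  rw [norm_one] at h1
  linarith

/-- Deflation of an affine sequence: `(∏_{σ∈rs}(S − σ))(n ↦ αn + β)_n = α·(n·Σ_j c_j + Σ_j j c_j) + β·Σ_j c_j` where `Σ_j c_jX^j = ∏_{σ∈rs}(X − σ)`
(plumbing, from `recDeflate_eq_sum_coeff`). [cite: Stanley2012EC1, §4.1 Theorem 4.1.1; lane plumbing] -/
theorem recDeflate_affine (rs : List ℂ) (α β : ℂ) (n : ℕ) :
    recDeflate rs (fun m : ℕ => α * (m : ℂ) + β) n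
      = α * ((n : ℂ) * ∑ j ∈ range (rs.length + 1), ((rs.map fun σ => X - C σ).prod).coeff j
          + ∑ j ∈ range (rs.length + 1), ((rs.map fun σ => X - C σ).prod).coeff j * (j : ℂ))
        + β * ∑ j ∈ range (rs.length + 1), ((rs.map fun σ => X - C σ).prod).coeff j := by
  simp only [recDeflate_eq_sum_coeff]
  have e : ∀ j : ℕ, ((rs.map fun σ => X - C σ).prod).coeff j * (α * ((n + j : ℕ) : ℂ) + β)
      = (α * (n : ℂ) + β) * ((rs.map fun σ => X - C σ).prod).coeff j + α * (((rs.map fun σ => X - C σ).prod).coeff j * (j : ℂ)) := by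
    intro j; push_cast; ring
  simp only [e, Finset.sum_add_distrib, ← Finset.mul_sum]
  ring

/-- The Gauss sum in the form `2·Σ_{i<n} i = n² − n` over `ℂ` (plumbing, private). [folklore] -/
private theorem two_mul_sum_range_cast_complex (n : ℕ) : 2 * ∑ i ∈ range n, (i : ℂ) = (n : ℂ) ^ 2 - n := by
  induction n with
  | zero => simp
  | succ n ih => rw [Finset.sum_range_succ, mul_add, ih]; push_cast; ring

/-! ## §3 The main theorem: simple dominant root `1`, source = (degree ≤ 1 polynomial) + (geometric error) -/

/-- ★★★ **Linear recurrence with a simple dominant root `1` and an affine-plus-geometric source.**  Let `q ∈ ℂ[X]` be MONIC with every root in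
`‖z‖ ≤ R`, `0 < R < 1`, and put `Q₁ := Σ_j q_j (= q(1) ≠ 0)`, `Q_d := Σ_j j·q_j (= q′(1))`.  If a sequence `w` satisfies, for all `n`,
`‖Σ_{j ≤ deg q} q_j·(w_{n+1+j} − w_{n+j}) − (ℓ₁·n + ℓ₀)‖ ≤ C·(n+1)^k·Rⁿ`
(the recurrence with characteristic polynomial `(X − 1)·q` driven by an affine source up to a geometric error), then with `α := ℓ₁/Q₁` and
`β := (ℓ₀ − α·Q_d)/Q₁` there are `m₀ ∈ ℂ` and `C' ≥ 0` with
`‖w_n − (α/2·n² + (β − α/2)·n + m₀)‖ ≤ C'·(n+1)^{k + deg q}·Rⁿ` for all `n`.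
Proof: `v_n := w_{n+1} − w_n − (αn + β)` is deflated by `q` into the geometric error (the affine part is matched exactly by the choice of `α, β`), so
`‖v_n‖ ≤ C₁(n+1)^{k+deg q}Rⁿ` by «DEFLATION — GENERAL ORDER»; then `w_n = w_0 + Σ_{i<n}(αi + β + v_i)` and the tail `Σ_{i≥n} v_i` is geometric.
[cite: Stanley2012EC1, §4.1 Theorem 4.1.1 (iii) and Corollary 4.3.1 (a pole of order `m` contributes a polynomial of degree `m − 1`); Feller1968, XIII.6; lane statement with explicit leading coefficients] -/
theorem exists_norm_sub_quadratic_le_of_linearRecurrence_one {q : ℂ[X]} (hq : q.Monic) {R : ℝ} (hR : 0 < R) (hR1 : R < 1)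
    (hroot : ∀ z : ℂ, q.IsRoot z → ‖z‖ ≤ R) {Q₁ Qd : ℂ}
    (hQ₁ : ∑ j ∈ range (q.natDegree + 1), q.coeff j = Q₁) (hQd : ∑ j ∈ range (q.natDegree + 1), q.coeff j * (j : ℂ) = Qd)
    {w : ℕ → ℂ} {ℓ₁ ℓ₀ : ℂ} {K : ℝ} {k : ℕ} (hK : 0 ≤ K)
    (hw : ∀ n : ℕ, ‖∑ j ∈ range (q.natDegree + 1), q.coeff j * (w (n + 1 + j) - w (n + j)) - (ℓ₁ * (n : ℂ) + ℓ₀)‖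
      ≤ K * ((n : ℝ) + 1) ^ k * R ^ n) :
    Q₁ ≠ 0 ∧ ∃ m₀ : ℂ, ∃ C' : ℝ, 0 ≤ C' ∧ ∀ n : ℕ,
      ‖w n - (ℓ₁ / Q₁ / 2 * (n : ℂ) ^ 2 + ((ℓ₀ - ℓ₁ / Q₁ * Qd) / Q₁ - ℓ₁ / Q₁ / 2) * (n : ℂ) + m₀)‖
        ≤ C' * ((n : ℝ) + 1) ^ (k + q.natDegree) * R ^ n := by
  -- `Q₁ = q(1) ≠ 0`
  have hQ₁ne : Q₁ ≠ 0 := by rw [← hQ₁, ← eval_one_eq_sum_range_coeff]; exact eval_one_ne_zero_of_root_norm_le hR1 hroot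
  refine ⟨hQ₁ne, ?_⟩
  -- the roots as a list, `∏(X − σ) = q`
  set rs : List ℂ := q.roots.toList with hrs
  have hcard : Multiset.card q.roots = q.natDegree := IsAlgClosed.card_roots_eq_natDegree
  have hprod : (rs.map fun σ => X - C σ).prod = q := by
    have h := prod_multiset_X_sub_C_of_monic_of_roots_card_eq hq hcard
    rw [hrs, ← Multiset.prod_coe, ← Multiset.map_coe, Multiset.coe_toList]
    exact h
  have hlen : rs.length = q.natDegree := by rw [hrs, Multiset.length_toList, hcard]
  have hmem : ∀ σ ∈ rs, ‖σ‖ ≤ R := fun σ hσ => by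
    rw [hrs, Multiset.mem_toList, mem_roots hq.ne_zero] at hσ
    exact hroot σ hσ
  -- the constants and the corrected increment sequence
  set α : ℂ := ℓ₁ / Q₁ with hα
  set β : ℂ := (ℓ₀ - α * Qd) / Q₁ with hβ
  have hαQ : α * Q₁ = ℓ₁ := by rw [hα]; exact div_mul_cancel₀ _ hQ₁ne
  have hβQ : β * Q₁ = ℓ₀ - α * Qd := by rw [hβ]; exact div_mul_cancel₀ _ hQ₁ne
  set v : ℕ → ℂ := fun n => w (n + 1) - w n - (α * (n : ℂ) + β) with hv
  -- deflating `v` gives exactly the geometric error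
  have hdefl : ∀ n : ℕ, recDeflate rs v n
      = ∑ j ∈ range (q.natDegree + 1), q.coeff j * (w (n + 1 + j) - w (n + j)) - (ℓ₁ * (n : ℂ) + ℓ₀) := by
    intro n
    have hsplit : recDeflate rs v n = recDeflate rs (fun m => w (m + 1) - w m) n - recDeflate rs (fun m : ℕ => α * (m : ℂ) + β) n := by
      rw [← recDeflate_sub]
    rw [hsplit, recDeflate_affine, recDeflate_eq_sum_coeff, hprod, hlen, hQ₁, hQd]
    have e1 : ∑ j ∈ range (q.natDegree + 1), q.coeff j * (w (n + j + 1) - w (n + j))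
        = ∑ j ∈ range (q.natDegree + 1), q.coeff j * (w (n + 1 + j) - w (n + j)) :=
      Finset.sum_congr rfl fun j _ => by rw [show n + j + 1 = n + 1 + j by ring]
    rw [e1]
    have e2 : α * ((n : ℂ) * Q₁ + Qd) + β * Q₁ = ℓ₁ * (n : ℂ) + ℓ₀ := by
      linear_combination (n : ℂ) * hαQ + hβQ
    rw [e2]
  have hvdefl : ∀ n : ℕ, ‖recDeflate rs v n‖ ≤ K * ((n : ℝ) + 1) ^ k * R ^ n := fun n => by rw [hdefl n]; exact hw n
  obtain ⟨C₁, hC₁, hvb⟩ := exists_norm_le_of_recDeflate hR rs hmem k K hK v hvdefl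
  rw [hlen] at hvb
  -- tails of `v`
  have htail := fun n => norm_tsum_nat_add_le_of_norm_le hR hR1 hC₁ hvb n
  have hvsum : Summable v := (htail 0).1
  set S : ℝ := ∑' j : ℕ, ((j : ℝ) + 1) ^ (k + q.natDegree) * R ^ j with hS
  have hS0 : 0 ≤ S := tsum_nonneg fun j => by positivity
  -- telescoping: `w n = w 0 + Σ_{i<n} (α i + β + v i)`
  have htel : ∀ n : ℕ, w n = w 0 + (α / 2 * ((n : ℂ) ^ 2 - n) + β * n) + ∑ i ∈ range n, v i := by
    intro n
    have h1 : ∑ i ∈ range n, (w (i + 1) - w i) = w n - w 0 := Finset.sum_range_sub w n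
    have h2 : ∑ i ∈ range n, (w (i + 1) - w i) = ∑ i ∈ range n, (α * (i : ℂ) + β) + ∑ i ∈ range n, v i := by
      rw [← Finset.sum_add_distrib]; exact Finset.sum_congr rfl fun i _ => by rw [hv]; ring
    have h3 : ∑ i ∈ range n, (α * (i : ℂ) + β) = α / 2 * ((n : ℂ) ^ 2 - n) + β * n := by
      rw [Finset.sum_add_distrib, ← Finset.mul_sum, Finset.sum_const, card_range, nsmul_eq_mul]
      have := two_mul_sum_range_cast_complex n
      linear_combination (α / 2) * this
    linear_combination h2 - h1 + h3
  -- the limit constant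
  set m₀ : ℂ := w 0 + ∑' i, v i with hm₀
  refine ⟨m₀, C₁ * S, mul_nonneg hC₁ hS0, fun n => ?_⟩
  have hsplit : ∑ i ∈ range n, v i - ∑' i, v i = -∑' i, v (i + n) := by
    rw [← hvsum.sum_add_tsum_nat_add n]; ring
  have e : w n - (ℓ₁ / Q₁ / 2 * (n : ℂ) ^ 2 + ((ℓ₀ - ℓ₁ / Q₁ * Qd) / Q₁ - ℓ₁ / Q₁ / 2) * (n : ℂ) + m₀) = -∑' i, v (i + n) := by
    rw [← hsplit, htel n, hm₀]
    ring
  rw [e, norm_neg]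
  exact (htail n).2

/-! ## §4 Real form -/

/-- ★★ **Real form of §3.**  A real sequence `w`, real source data `ℓ₁, ℓ₀`, and a monic `q ∈ ℂ[X]` (all roots in `‖z‖ ≤ R`, `0 < R < 1`) whose
coefficient sums are real: `Σ_j q_j = Q₁`, `Σ_j j q_j = Q_d`.  If `‖Σ_j q_j·(w_{n+1+j} − w_{n+j}) − (ℓ₁ n + ℓ₀)‖ ≤ C(n+1)^kRⁿ` for all `n`, then with
`α = ℓ₁/Q₁`, `β = (ℓ₀ − αQ_d)/Q₁` there are real `m₀`, `C'` with `|w_n − (α/2·n² + (β − α/2)·n + m₀)| ≤ C'(n+1)^{k+deg q}Rⁿ`; and `Q₁ ≠ 0`.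
This is the shape used by the strip files (the LINEAR law is the case `ℓ₁ = 0`).
[cite: Stanley2012EC1, §4.1 Theorem 4.1.1 (iii), Corollary 4.3.1; Feller1968, XIII.6; lane statement] -/
theorem exists_abs_sub_quadratic_le_of_linearRecurrence_one_real {q : ℂ[X]} (hq : q.Monic) {R : ℝ} (hR : 0 < R) (hR1 : R < 1)
    (hroot : ∀ z : ℂ, q.IsRoot z → ‖z‖ ≤ R) {Q₁ Qd : ℝ}
    (hQ₁ : ∑ j ∈ range (q.natDegree + 1), q.coeff j = (Q₁ : ℂ))
    (hQd : ∑ j ∈ range (q.natDegree + 1), q.coeff j * (j : ℂ) = (Qd : ℂ))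
    {w : ℕ → ℝ} {ℓ₁ ℓ₀ K : ℝ} {k : ℕ} (hK : 0 ≤ K)
    (hw : ∀ n : ℕ, ‖∑ j ∈ range (q.natDegree + 1), q.coeff j * (((w (n + 1 + j) : ℝ) : ℂ) - ((w (n + j) : ℝ) : ℂ))
        - (((ℓ₁ : ℝ) : ℂ) * (n : ℂ) + ((ℓ₀ : ℝ) : ℂ))‖ ≤ K * ((n : ℝ) + 1) ^ k * R ^ n) :
    Q₁ ≠ 0 ∧ ∃ m₀ : ℝ, ∃ C' : ℝ, 0 ≤ C' ∧ ∀ n : ℕ,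
      |w n - (ℓ₁ / Q₁ / 2 * (n : ℝ) ^ 2 + ((ℓ₀ - ℓ₁ / Q₁ * Qd) / Q₁ - ℓ₁ / Q₁ / 2) * (n : ℝ) + m₀)|
        ≤ C' * ((n : ℝ) + 1) ^ (k + q.natDegree) * R ^ n := by
  obtain ⟨hQ, m₀, C', hC', hb⟩ :=
    exists_norm_sub_quadratic_le_of_linearRecurrence_one (w := fun m => ((w m : ℝ) : ℂ)) hq hR hR1 hroot hQ₁ hQd hK hw
  have hQ₁ne : Q₁ ≠ 0 := fun h => hQ (by rw [h, Complex.ofReal_zero])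
  refine ⟨hQ₁ne, m₀.re, C', hC', fun n => ?_⟩
  have h := hb n
  -- the polynomial part is real
  set P : ℝ := ℓ₁ / Q₁ / 2 * (n : ℝ) ^ 2 + ((ℓ₀ - ℓ₁ / Q₁ * Qd) / Q₁ - ℓ₁ / Q₁ / 2) * (n : ℝ) with hP
  have hPc : ((ℓ₁ : ℝ) : ℂ) / (Q₁ : ℂ) / 2 * (n : ℂ) ^ 2
      + ((((ℓ₀ : ℝ) : ℂ) - ((ℓ₁ : ℝ) : ℂ) / (Q₁ : ℂ) * (Qd : ℂ)) / (Q₁ : ℂ) - ((ℓ₁ : ℝ) : ℂ) / (Q₁ : ℂ) / 2) * (n : ℂ)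
      = ((P : ℝ) : ℂ) := by
    rw [hP]; push_cast; ring
  have hre : (((w n : ℝ) : ℂ) - ((((ℓ₁ : ℝ) : ℂ) / (Q₁ : ℂ) / 2 * (n : ℂ) ^ 2
      + ((((ℓ₀ : ℝ) : ℂ) - ((ℓ₁ : ℝ) : ℂ) / (Q₁ : ℂ) * (Qd : ℂ)) / (Q₁ : ℂ) - ((ℓ₁ : ℝ) : ℂ) / (Q₁ : ℂ) / 2) * (n : ℂ)) + m₀)).re
      = w n - (P + m₀.re) := by
    rw [hPc, Complex.sub_re, Complex.add_re, Complex.ofReal_re, Complex.ofReal_re]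
  rw [← hre]
  exact (Complex.abs_re_le_norm _).trans h

end Literature.Analysis
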